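import Summits.QuantumFields.YangMills.Theses.LangevinControlUV
import Literature.MathematicalPhysics.QuantumFieldTheory.MassGapFromLatticeClustering

/-!
# Crux `GapToContinuum` (stmt-QuantumFields-8896) — round-2 ideator 4: the DIAGONAL interface (R5)
# and the continuum-side self-improvement lemma (L1)

Evidence file (elaborates; no `sorry`). Nothing here is proposed to the tree.

**L1 (continuum-side diagonal self-improvement; Literature-grade target `DiagBoundToGap`).**
For OS data `T` it suffices, for the FULL-spectrum gap `T.HasMassGap Δ`, that every slab-ordered
real product tensor `P` (every arity `n ≥ 1`, every species string `σ`) satisfies the DIAGONAL bound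
`‖𝔖₂ₙ^{σʳσ}(ΘP* ⊗ T_t P) − 𝔖ₙ^{σʳ}(ΘP*) 𝔖ₙ^{σ}(P)‖ ≤ C(P) e^{−Δt}` (`t ≥ 0`) with an ARBITRARY
constant `C(P)` (no continuity in `P`, no Cauchy–Schwarz form, no finite families).  Proof sketch
(all inside `T`, using only E0-hermiticity, E1-time-translation, E2):
(i) `W_P(t) := 𝔖(ΘP* ⊗ T_tP) − |𝔖(P)|²` is the E2 form of the two-term list
    `(−𝔖(P)·𝟙₀, T_{t/2}P)` with itself, hence real `≥ 0`, and `W_P((t+s)/2)² ≤ W_P(t) W_P(s)`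
    (Cauchy–Schwarz for the E2 form + E1) — log-convexity with INFINITE horizon;
(ii) dyadic iteration `W(t)^{2^J} ≤ W(0)^{2^J−1} W(2^J t) ≤ W(0)^{2^J−1} C e^{−Δ2^J t}` and `J → ∞`
    (legal for every `t`: no horizon in the continuum) give `W_P(t) ≤ W_P(0) e^{−Δt}` — the
    constant self-improves to the OS variance (this is the tree's
    `ReflectedCorrelationLogConvexity` iteration, whose loss factor `(C/W(0))^{2^{-J}}` here tends
    to `1` because `C` is a FIXED number and `J` is unbounded);
(iii) for `F = Σ cᵢPᵢ` in the span, `t ↦ W_F(t)` is a PSD quadratic form in `F`, so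
    `W_F(t) ≤ N Σ|cᵢ|² W_{Pᵢ}(t) ≤ C_F e^{−Δt}`, then (ii) again: `W_F(t) ≤ W_F(0)e^{−Δt}`;
(iv) Cauchy–Schwarz for the E2 form: `|𝔖(ΘF* ⊗ T_tG) − 𝔖(ΘF*)𝔖(G)| ≤ √W_F(t) √W_G(t)
    ≤ e^{−Δt} √𝔖(ΘF*⊗F) √𝔖(ΘG*⊗G)` on span × span — exactly the hypothesis of the tree's
    `OSData.hasMassGap_of_csBound_span`, which concludes.
The tree's reductions (`hasMassGap_of_csBound_span`, `hasMassGap_of_clustersCS`, sibling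
`hasMassGap_of_dense_clustering`) all require constants CONTINUOUS in `(F, G)`; L1 removes that.

**R5 (restated crux, diagonal interface).** `GapToContinuumDiag`: `IsYangMillsFor r sch T` and
`sch.HasDiagClustering r Δ` (per single slab-ordered real factor datum, diagonal, FREE constant,
eventually in `k` with slack `ε`) give `T.HasMassGap Δ`.  `gapToContinuumDiag_of_diagBoundToGap`
(proved below) reduces R5 to L1; `hasDiagClustering_of_hasCSClustering` (proved below) shows R5's
lattice hypothesis is implied by R1's (`HasCSClustering`, Restatement.lean) given `IsYangMillsFor`.

Why this does NOT rescue the crux AS TYPED (memo `Negative-notes/round2-ideator4.md`): the typed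
hypothesis `HasLatticeMassGap` has per-pair ABSOLUTE constants and per-pair thresholds; neither sums
under renormalised smearing (`c_s(k)` free) on the scheme's own tori (defects D2, D3(b) of the dead
lines are untouched by L1; only D3(a), the OS-currency requirement, disappears).
-/

noncomputable section

open scoped SchwartzMap ComplexConjugate BigOperators
open MeasureTheory Filter Topology Complex
open Literature.MathematicalPhysics.AQFT Literature.MathematicalPhysics.QuantumLattice
open Literature.MathematicalPhysics.QuantumFieldTheory

namespace Summit.QuantumFields.YangMills.Cruxes.GapToContinuum.Ideator4

open Summit.QuantumFields.YangMills.Theses.LangevinControlUV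

/-! ## §1 The continuum-side lemma L1 as a typed target -/

/-- **Diagonal clustering bound of OS data on slab-ordered real product tensors** (free constant
per tensor). [folklore] -/
def DiagBound {ι : Type} {d : ℕ} [NeZero d] (T : OSData ι d) (Δ : ℝ) : Prop :=
  ∀ (n : ℕ), n ≠ 0 → ∀ (σ : Fin n → ι) (p : Fin n → 𝓢(EuclideanSpace ℝ (Fin d), ℝ)),
    IsSlabOrdered p → ∀ (P : 𝓢((Fin n → EuclideanSpace ℝ (Fin d)), ℂ)),
      IsTensorOf P (fun l => ofRealTest (p l)) →
        ∃ C : ℝ, ∀ t : ℝ, 0 ≤ t →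
          ‖T.schwinger (n + n) (Fin.append (σ ∘ Fin.rev) σ)
                ((osAdjoint P).appendTensor (translateMulti (EuclideanSpace.single 0 t) P)) -
              T.schwinger n (σ ∘ Fin.rev) (osAdjoint P) * T.schwinger n σ P‖ ≤
            C * Real.exp (-Δ * t)

/-- **L1 (target Literature lemma): diagonal bounds with free constants on the total set of
slab-ordered real product tensors give the full-spectrum gap** (E2 log-convexity with infinite
horizon + PSD span step + Cauchy–Schwarz + `hasMassGap_of_csBound_span`; `d ≥ 2` for the
degree-`0` E4 step of the tree). Stated as a `Prop`; not proved here. [folklore] -/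
def DiagBoundToGap : Prop :=
  ∀ (ι : Type) (d : ℕ) [NeZero d], 1 < d → ∀ (T : OSData ι d) (Δ : ℝ), DiagBound T Δ → T.HasMassGap Δ

/-! ## §2 The lattice-facing diagonal interface -/

/-- **Diagonal clustering at rate `Δ` of a lattice approximation `Λ`**: for every arity `n ≥ 1`,
label string `σ` and ONE slab-ordered real factor datum `p` there is a constant `C` such that for
all `t ≥ 0`, `ε > 0`, eventually in `k`,
`‖Λᵏ₂ₙ(θpʳ ++ T_t p) − Λᵏₙ(θpʳ) Λᵏₙ(p)‖ ≤ C e^{−Δt} + ε`. (The `N = N' = 1`, `q = p`, `c = c' = 1`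
instance of the tree's `ClustersCS`, with the Cauchy–Schwarz right-hand side replaced by a free
constant.) [folklore] -/
def ClustersDiag {ι : Type} (d : ℕ) [NeZero d]
    (Λ : ℕ → (n : ℕ) → (Fin n → ι) → (Fin n → 𝓢(EuclideanSpace ℝ (Fin d), ℝ)) → ℂ) (Δ : ℝ) : Prop :=
  ∀ (n : ℕ), n ≠ 0 → ∀ (σ : Fin n → ι) (p : Fin n → 𝓢(EuclideanSpace ℝ (Fin d), ℝ)),
    IsSlabOrdered p → ∃ C : ℝ, ∀ t : ℝ, 0 ≤ t → ∀ ε : ℝ, 0 < ε → ∀ᶠ k in atTop,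
      ‖Λ k (n + n) (Fin.append (σ ∘ Fin.rev) σ)
            (Fin.append (fun l => thetaTest d (p (Fin.rev l)))
              (fun l => translateTest (EuclideanSpace.single 0 t) (p l))) -
          Λ k n (σ ∘ Fin.rev) (fun l => thetaTest d (p (Fin.rev l))) * Λ k n σ p‖ ≤
        C * Real.exp (-Δ * t) + ε

variable {G : Type} [Group G] [TopologicalSpace G] [IsTopologicalGroup G] [CompactSpace G]
  [MeasurableSpace G] [BorelSpace G]

/-- **`sch.HasDiagClustering r Δ`**: `ClustersDiag` for the lattice `n`-point functions
`latticeSchwinger r.ρ sch` of the smeared renormalised gauge-invariant local observables on the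
scheme's own tori. [folklore] -/
def HasDiagClustering (r : LatticeRep G) (sch : SpeciesScheme (YMSpecies G)) (Δ : ℝ) : Prop :=
  ClustersDiag 4 (fun k n σ f => ((latticeSchwinger r.ρ sch (fun s => s.F) k n σ f : ℝ) : ℂ)) Δ

/-- **R5 (restated crux, diagonal interface).** -/
def GapToContinuumDiag : Prop :=
  ∀ (G : Type) [Group G] [TopologicalSpace G] [IsTopologicalGroup G] [CompactSpace G]
    [MeasurableSpace G] [BorelSpace G] (r : LatticeRep G) (sch : SpeciesScheme (YMSpecies G))
    (T : OSData (YMSpecies G) 4) (Δ : ℝ), 0 < Δ → IsYangMillsFor r sch T →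
      HasDiagClustering r sch Δ → T.HasMassGap Δ

/-- **The limit passage: `IsYangMillsFor` + `HasDiagClustering` ⇒ `DiagBound T Δ`** (termwise
limits of the three lattice quantities on off-diagonal real product tensors, then `ε → 0`).
[folklore] -/
theorem diagBound_of_hasDiagClustering {r : LatticeRep G} {sch : SpeciesScheme (YMSpecies G)}
    {T : OSData (YMSpecies G) 4} (hYM : IsYangMillsFor r sch T) {Δ : ℝ}
    (h : HasDiagClustering r sch Δ) : DiagBound T Δ := by
  intro n hn σ p hp P hP
  obtain ⟨C, hC⟩ := h n hn σ p hp
  have hPt : IsTimeOrdered P := IsTimeOrdered.of_mem_slabOrderedProducts (hp.mem_slabOrderedProducts hP)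
  refine ⟨C, fun t ht => ?_⟩
  set a : EuclideanSpace ℝ (Fin 4) := EuclideanSpace.single 0 t with ha
  set Λ : ℕ → (n : ℕ) → (Fin n → YMSpecies G) → (Fin n → 𝓢(EuclideanSpace ℝ (Fin 4), ℝ)) → ℂ :=
    fun k n σ f => ((latticeSchwinger r.ρ sch (fun s => s.F) k n σ f : ℝ) : ℂ) with hΛ
  -- the three lattice quantities converge to their continuum counterparts
  have hA : Tendsto (fun k => Λ k (n + n) (Fin.append (σ ∘ Fin.rev) σ)
        (Fin.append (fun l => thetaTest 4 (p (Fin.rev l))) (fun l => translateTest a (p l))))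
      atTop (𝓝 (T.schwinger (n + n) (Fin.append (σ ∘ Fin.rev) σ)
        ((osAdjoint P).appendTensor (translateMulti a P)))) := by
    refine hYM (n + n) (by omega) _ _ _ ?_ ?_
    · have h1 := hP.osAdjoint.appendTensor (hP.translateMulti a)
      rwa [append_ofRealTest] at h1
    · exact OSReconstructionNoE1.isOffDiagonal_appendTensor_osAdjoint hPt
        (OSReconstructionNoE1.isTimeOrdered_translateMulti hPt (by simp [ha, ht]))
  have hB : Tendsto (fun k => Λ k n (σ ∘ Fin.rev) (fun l => thetaTest 4 (p (Fin.rev l))))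
      atTop (𝓝 (T.schwinger n (σ ∘ Fin.rev) (osAdjoint P))) :=
    hYM n hn _ _ _ hP.osAdjoint hPt.isOffDiagonal.osAdjoint
  have hC' : Tendsto (fun k => Λ k n σ p) atTop (𝓝 (T.schwinger n σ P)) :=
    hYM n hn _ _ _ hP hPt.isOffDiagonal
  have hlim : Tendsto (fun k => ‖Λ k (n + n) (Fin.append (σ ∘ Fin.rev) σ)
        (Fin.append (fun l => thetaTest 4 (p (Fin.rev l))) (fun l => translateTest a (p l))) -
        Λ k n (σ ∘ Fin.rev) (fun l => thetaTest 4 (p (Fin.rev l))) * Λ k n σ p‖)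
      atTop (𝓝 ‖T.schwinger (n + n) (Fin.append (σ ∘ Fin.rev) σ)
          ((osAdjoint P).appendTensor (translateMulti a P)) -
        T.schwinger n (σ ∘ Fin.rev) (osAdjoint P) * T.schwinger n σ P‖) :=
    (hA.sub (hB.mul hC')).norm
  refine le_of_forall_pos_le_add fun ε hε => ?_
  exact le_of_tendsto_of_tendsto hlim tendsto_const_nhds (hC t ht ε hε)

/-- **R5 reduces to L1.** [folklore] -/
theorem gapToContinuumDiag_of_diagBoundToGap (hL1 : DiagBoundToGap) : GapToContinuumDiag :=
  fun _G _ _ _ _ _ _ _r _sch T Δ _ hYM hdiag =>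
    hL1 _ 4 (by norm_num) T Δ (diagBound_of_hasDiagClustering hYM hdiag)

/-- **R5's lattice hypothesis is weaker than R1's**: given `IsYangMillsFor` (boundedness of the
lattice `2n`-point norms along the scheme), `sch.HasCSClustering r Δ` implies
`HasDiagClustering r sch Δ` (the `N = N' = 1`, `c = 1` instance, constant
`‖𝔖₂ₙ(ΘP* ⊗ P)‖ + 1`). [folklore] -/
theorem hasDiagClustering_of_hasCSClustering {r : LatticeRep G} {sch : SpeciesScheme (YMSpecies G)}
    {T : OSData (YMSpecies G) 4} (hYM : IsYangMillsFor r sch T) {Δ : ℝ}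
    (h : sch.HasCSClustering r Δ) : HasDiagClustering r sch Δ := by
  intro n hn σ p hp
  obtain ⟨P, hP⟩ : ∃ P : 𝓢((Fin n → EuclideanSpace ℝ (Fin 4)), ℂ),
      IsTensorOf P (fun l => ofRealTest (p l)) := exists_isTensorOf _
  have hPt : IsTimeOrdered P := IsTimeOrdered.of_mem_slabOrderedProducts (hp.mem_slabOrderedProducts hP)
  set Λ : ℕ → (n : ℕ) → (Fin n → YMSpecies G) → (Fin n → 𝓢(EuclideanSpace ℝ (Fin 4), ℝ)) → ℂ :=
    fun k n σ f => ((latticeSchwinger r.ρ sch (fun s => s.F) k n σ f : ℝ) : ℂ) with hΛ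
  -- the lattice OS "norm" converges, hence is eventually bounded by its limit + 1
  set V : ℝ := ‖T.schwinger (n + n) (Fin.append (σ ∘ Fin.rev) σ) ((osAdjoint P).appendTensor P)‖
    with hV
  have hD : Tendsto (fun k => Λ k (n + n) (Fin.append (σ ∘ Fin.rev) σ)
        (Fin.append (fun l => thetaTest 4 (p (Fin.rev l))) p))
      atTop (𝓝 (T.schwinger (n + n) (Fin.append (σ ∘ Fin.rev) σ) ((osAdjoint P).appendTensor P))) := by
    refine hYM (n + n) (by omega) _ _ _ ?_ ?_
    · have h1 := hP.osAdjoint.appendTensor hP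
      rwa [append_ofRealTest] at h1
    · exact OSReconstructionNoE1.isOffDiagonal_appendTensor_osAdjoint hPt hPt
  have hDn : ∀ᶠ k in atTop, ‖Λ k (n + n) (Fin.append (σ ∘ Fin.rev) σ)
      (Fin.append (fun l => thetaTest 4 (p (Fin.rev l))) p)‖ ≤ V + 1 := by
    have := hD.norm
    exact (this.eventually (Iio_mem_nhds (by linarith : V < V + 1))).mono fun k hk => hk.le
  refine ⟨V + 1, fun t ht ε hε => ?_⟩
  have hcs := h n n hn hn σ σ 1 1 (fun _ => 1) (fun _ => 1) (fun _ => p) (fun _ => p)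
    (fun _ => hp) (fun _ => hp) t ht ε hε
  filter_upwards [hcs, hDn] with k hk hk'
  have hk1 : ‖Λ k (n + n) (Fin.append (σ ∘ Fin.rev) σ)
        (Fin.append (fun l => thetaTest 4 (p (Fin.rev l)))
          (fun l => translateTest (EuclideanSpace.single 0 t) (p l))) -
        Λ k n (σ ∘ Fin.rev) (fun l => thetaTest 4 (p (Fin.rev l))) * Λ k n σ p‖ ≤
      Real.exp (-Δ * t) *
        Real.sqrt ‖Λ k (n + n) (Fin.append (σ ∘ Fin.rev) σ)
          (Fin.append (fun l => thetaTest 4 (p (Fin.rev l))) p)‖ *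
        Real.sqrt ‖Λ k (n + n) (Fin.append (σ ∘ Fin.rev) σ)
          (Fin.append (fun l => thetaTest 4 (p (Fin.rev l))) p)‖ + ε := by
    simpa only [Fin.sum_univ_one, map_one, one_mul, hΛ] using hk
  have hsq : Real.sqrt ‖Λ k (n + n) (Fin.append (σ ∘ Fin.rev) σ)
          (Fin.append (fun l => thetaTest 4 (p (Fin.rev l))) p)‖ *
        Real.sqrt ‖Λ k (n + n) (Fin.append (σ ∘ Fin.rev) σ)
          (Fin.append (fun l => thetaTest 4 (p (Fin.rev l))) p)‖ ≤ V + 1 := by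
    rw [Real.mul_self_sqrt (norm_nonneg _)]; exact hk'
  have hexp : 0 ≤ Real.exp (-Δ * t) := (Real.exp_pos _).le
  calc _ ≤ _ := hk1
    _ ≤ (V + 1) * Real.exp (-Δ * t) + ε := by
        rw [mul_assoc]; nlinarith [mul_le_mul_of_nonneg_left hsq hexp]

end Summit.QuantumFields.YangMills.Cruxes.GapToContinuum.Ideator4

end
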